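import Mathlib
import Summits.QuantumFields.BalabanUV.T4Continuum.Support.SliceFlatOperators

/-!
# T⁴ programme, node NE3 (η-rate of the minimisers) — THE FLAT RUNG, part 3: the level-free principal part of the flat
# family IS the unit vector-Laplacian stencil at EVERY level, so the remainder form `N_j` is exactly Bałaban's gauge part
# `−η²∂P_j∂*` plus the line-vs-block averaging deviation (no Laplacian residue)

Thirteenth generation of the NE3 prover lineage P1 of the cell `pub-balaban`, file 7.  Part 2 (`SliceFlatOperators`,
p199225) wrote the flat level operators as `kFlat j = flatE + massKernel_j + flatNg j` with `flatE := RI 0 (LapR 1 M₀)` (the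
unit vector Laplacian of [B5] (1.90) transported from level 0) and `flatNg j` DEFINED as the remainder, noting that it contains
the difference `η_j²·RI j LapR_j − flatE`, «which vanishes but is not proved».  THIS FILE proves it:
 * §1 the explicit STENCIL `stencilE` on `(ℤ/NL^k)^{d+1} × Fin (d+1)`: `E p q = Σ_ν [(δ_{pq} − δ_{(p₁+e_ν,p₂),q}) +
   (δ_{pq} − δ_{(p₁−e_ν,p₂),q})]` (componentwise graph Laplacian, `2(d+1)` on the diagonal, `−1` on nearest neighbours);
 * §2 the entries of pv15's real vector Laplacian `LapR n M = Re Σ_ν ∇_ν*∇_ν` (from their `re_LapOne_mulVec`):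
   `LapR i i′ = n²·Σ_ν [(δ − δ(i+e_ν)) + (δ − δ(i−e_ν))]`, and the transport of unit steps through the reindexing
   (`eF (x ± e_ν) = eF x ± e_ν`: `eF` is a ring isomorphism coordinatewise);
 * §3 **`scaled_LapR_eq_stencil`**: `η_j² • RI j (LapR (L^{min(j,k)}) M_j) = stencilE` for EVERY `j` — level-free, as the
   E-edition requires; hence **`flatE_eq_stencil`** and **`flatNg_eq`**: `flatNg j = −η_j²·RI j Re(∂P_j∂*) + (η_j²·RI j
   Re(a·Q*Q) − massKernel (cubeI j) τ_j (1/(L^j)^{d+3}))` — the remainder form of the flat family is EXACTLY Bałaban's gauge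
   part of [B5] (1.69)–(1.70) (negative) plus the deviation of the line-averaged mass term of (1.8) from the block-diagonal
   model, with NO Laplacian residue.  (Their (3.49)-type kernel bounds are NOT attempted here: pv15's `PcT` decay and the
   explicit `QvAdj·QvOp` entries are the successor's inputs.)

Honest framing: finite-T⁴ ultraviolet bookkeeping about MINIMISERS (rung (B)+1 of the cell's ladder); no conditional of the
cell (`BetaPertH`, (B), (B^μ)) is used or hidden; nothing bears on infinite volume, a mass gap, or the Clay problem; NE3 is NOT
proved.  ABSOLUTE RULE of the cell kept: inputs are kernel-proved tree modules only (pv15's `B5G183FreeRowSum.re_LapOne_mulVec`,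
`B5RealFields`, `B5DeltaA169`; the lineage's flat-rung files).  No `sorry`, no axioms beyond Mathlib's.  PLACEMENT (human rule
2026-08-19): cell work under `Summits/QuantumFields/BalabanUV/`; imports `Support.SliceFlatOperators` (p199225); moves
nothing.  Records: `t4/T4-EST-U1b-OSC.md` v1.26 (RESULT 34), `t4/T4-EST-NE3-P1.md` v2.25, GAPS G-ne3p1-40 of the cell
`pub-balaban`.
-/

noncomputable section

open Finset Real Matrix

namespace Summit.QuantumFields.BalabanUV.T4Continuum.SliceFlatStencil

open Literature.MathematicalPhysics.QuantumFieldTheory.Balaban1983to89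
open Literature.MathematicalPhysics.QuantumFieldTheory.Balaban1983to89.TreeLengthTorus (TPt)
open Literature.MathematicalPhysics.QuantumFieldTheory.Balaban1983to89.B5Prop11Plancherel (Tor fine unitVec)
open Literature.MathematicalPhysics.QuantumFieldTheory.Balaban1983to89.B5Prop11Lower (Lap)
open Literature.MathematicalPhysics.QuantumFieldTheory.Balaban1983to89.B5Action121 (GradOp)
open Literature.MathematicalPhysics.QuantumFieldTheory.Balaban1983to89.B5Value126 (PcT)
open Literature.MathematicalPhysics.QuantumFieldTheory.Balaban1983to89.B5Block118 (QvOp)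
open Literature.MathematicalPhysics.QuantumFieldTheory.Balaban1983to89.B5DeltaA169 (DeltaA QvAdj)
open Literature.MathematicalPhysics.QuantumFieldTheory.Balaban1983to89.B5RealFields
  (reM DeltaAR LapR reM_add reM_sub reM_smul_ofReal)
open Literature.MathematicalPhysics.QuantumFieldTheory.Balaban1983to89.B5G183FreeRowSum (re_LapOne_mulVec)
open Literature.MathematicalPhysics.QuantumFieldTheory.Balaban1983to89.T4SliceOperatorData (massKernel)
open Summit.QuantumFields.BalabanUV.T4Continuum.SliceTorusBlocks
open Summit.QuantumFields.BalabanUV.T4Continuum.SliceTorusTower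
open Summit.QuantumFields.BalabanUV.T4Continuum.SliceCovariantModel
open Summit.QuantumFields.BalabanUV.T4Continuum.SliceCovariantTower
open Summit.QuantumFields.BalabanUV.T4Continuum.SliceTorusComb
open Summit.QuantumFields.BalabanUV.T4Continuum.SliceFlatPropagator
open Summit.QuantumFields.BalabanUV.T4Continuum.SliceFlatOperators

/-! ## §1  The unit vector-Laplacian stencil on the NE3 carrier -/
section Stencil

variable (d k N L : ℕ)

/-- The Kronecker delta on the internal-index carrier. [folklore] -/
def kd (p q : TPt (d + 1) (N * L ^ k) × Fin (d + 1)) : ℝ := if p = q then 1 else 0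

/-- **THE UNIT VECTOR-LAPLACIAN STENCIL** `E p q = Σ_ν [(δ_{pq} − δ_{(p₁+e_ν,p₂),q}) + (δ_{pq} − δ_{(p₁−e_ν,p₂),q})]` on
`(ℤ/NL^k)^{d+1} × Fin (d+1)` (the componentwise graph Laplacian `Σ_ν ∇_ν*∇_ν` at lattice spacing `1`). [model] [folklore] -/
def stencilE : Matrix (TPt (d + 1) (N * L ^ k) × Fin (d + 1)) (TPt (d + 1) (N * L ^ k) × Fin (d + 1)) ℝ :=
  fun p q => ∑ ν : Fin (d + 1), ((kd d k N L p q - kd d k N L (p.1 + Pi.single ν 1, p.2) q)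
    + (kd d k N L p q - kd d k N L (p.1 - Pi.single ν 1, p.2) q))

end Stencil

/-! ## §2  Entries of pv15's vector Laplacian and the transport of unit steps -/
section Entries

variable {d : ℕ} (n : ℕ) [NeZero n] (M : Fin (d + 1) → ℕ) [∀ μ, NeZero (M μ)]

/-- **Entries of the real vector Laplacian of [B5]** (from pv15's `re_LapOne_mulVec` on a unit impulse):
`LapR i i′ = n²·Σ_ν [(δ_{ii′} − δ_{(i₁+e_ν,i₂),i′}) + (δ_{ii′} − δ_{(i₁−e_ν,i₂),i′})]`. [folklore] -/
theorem LapR_apply (i i' : Tor (fine n M) × Fin (d + 1)) :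
    LapR n M i i' = (n : ℝ) ^ 2 * ∑ ν, (((if i = i' then (1 : ℝ) else 0) - (if (i.1 + unitVec (fine n M) ν, i.2) = i' then 1 else 0))
      + ((if i = i' then (1 : ℝ) else 0) - (if (i.1 - unitVec (fine n M) ν, i.2) = i' then 1 else 0))) := by
  have hcol : LapR n M i i' = ((Lap n M *ᵥ Pi.single i' (1 : ℂ)) i).re := by
    rw [Matrix.mulVec_single_one]; rfl
  have hsplit : ((Lap n M *ᵥ Pi.single i' (1 : ℂ)) i).re
      = (((Lap n M + 1) *ᵥ Pi.single i' (1 : ℂ)) i).re - ((Pi.single i' (1 : ℂ) : _ → ℂ) i).re := by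
    rw [Matrix.add_mulVec, Matrix.one_mulVec, Pi.add_apply, Complex.add_re]; ring
  rw [hcol, hsplit, re_LapOne_mulVec]
  have hδ : ∀ x : Tor (fine n M) × Fin (d + 1), ((Pi.single i' (1 : ℂ) : _ → ℂ) x).re = if x = i' then 1 else 0 := by
    intro x
    by_cases h : x = i'
    · subst h; simp
    · rw [Pi.single_eq_of_ne h, if_neg h]; simp
  simp_rw [hδ]
  ring

end Entries

section Transport

variable (d k N L : ℕ)

/-- The reindexing is additive. [folklore] -/
theorem eF_add (j : ℕ) (x y : TPt (d + 1) (N * L ^ k)) : eF d k N L j (x + y) = eF d k N L j x + eF d k N L j y := by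
  funext μ; exact map_add (castF k N L j) (x μ) (y μ)

/-- The reindexing is subtractive. [folklore] -/
theorem eF_sub (j : ℕ) (x y : TPt (d + 1) (N * L ^ k)) : eF d k N L j (x - y) = eF d k N L j x - eF d k N L j y := by
  funext μ; exact map_sub (castF k N L j) (x μ) (y μ)

/-- The reindexing maps unit vectors to unit vectors. [folklore] -/
theorem eF_single (j : ℕ) (ν : Fin (d + 1)) :
    eF d k N L j (Pi.single ν 1) = unitVec (fine (side k L j) (Mlev d k N L j)) ν := by
  funext μ
  show castF k N L j ((Pi.single ν (1 : ZMod (N * L ^ k)) : TPt (d + 1) (N * L ^ k)) μ)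
    = (Pi.single ν 1 : Tor (fine (side k L j) (Mlev d k N L j))) μ
  by_cases h : μ = ν
  · subst h; rw [Pi.single_eq_same, Pi.single_eq_same, map_one]
  · rw [Pi.single_eq_of_ne h, Pi.single_eq_of_ne h, map_zero]

/-- Transported unit steps: `(eF p₁ ± e_ν, p₂) = (eF q₁, q₂) ↔ (p₁ ± e_ν, p₂) = q`. [folklore] -/
theorem eF_step_eq_iff (j : ℕ) (ν : Fin (d + 1)) (p q : TPt (d + 1) (N * L ^ k) × Fin (d + 1)) :
    ((eF d k N L j p.1 + unitVec (fine (side k L j) (Mlev d k N L j)) ν, p.2) = (eF d k N L j q.1, q.2)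
      ↔ (p.1 + Pi.single ν 1, p.2) = q) ∧
    ((eF d k N L j p.1 - unitVec (fine (side k L j) (Mlev d k N L j)) ν, p.2) = (eF d k N L j q.1, q.2)
      ↔ (p.1 - Pi.single ν 1, p.2) = q) := by
  rw [← eF_single, ← eF_add, ← eF_sub]
  constructor <;>
  · rw [Prod.mk.injEq, (eF d k N L j).apply_eq_iff_eq]
    constructor
    · rintro ⟨h1, h2⟩; exact Prod.ext h1 h2
    · rintro rfl; exact ⟨rfl, rfl⟩

end Transport

/-! ## §3  The scaled transported Laplacian IS the stencil at every level; the remainder form decomposed -/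
section Identification

variable (d k N L : ℕ) [NeZero N] [NeZero L]

omit [NeZero N] [NeZero L] in
/-- Reindexing is subtractive. [folklore] -/
theorem RI_sub (j : ℕ) (A B : Matrix (Tor (fine (side k L j) (Mlev d k N L j)) × Fin (d + 1))
    (Tor (fine (side k L j) (Mlev d k N L j)) × Fin (d + 1)) ℝ) : RI d k N L j (A - B) = RI d k N L j A - RI d k N L j B := by
  unfold RI; rw [Matrix.reindex_apply, Matrix.reindex_apply, Matrix.reindex_apply, Matrix.submatrix_sub]; rfl

/-- **`η_j² · RI j (LapR n_j M_j) = stencilE` FOR EVERY LEVEL `j`** — the level-free principal part of the flat family is the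
unit vector-Laplacian stencil. [folklore] -/
theorem scaled_LapR_eq_stencil (j : ℕ) :
    ((side k L j : ℝ) ^ 2)⁻¹ • RI d k N L j (LapR (side k L j) (Mlev d k N L j)) = stencilE d k N L := by
  have hn : ((side k L j : ℝ) ^ 2) ≠ 0 := by have := one_le_side k L j; positivity
  ext p q
  rw [Matrix.smul_apply, RI_apply, LapR_apply, smul_eq_mul, ← mul_assoc, inv_mul_cancel₀ hn, one_mul, stencilE]
  refine Finset.sum_congr rfl fun ν _ => ?_
  have hpq : ((eF d k N L j p.1, p.2) = (eF d k N L j q.1, q.2)) ↔ p = q := by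
    rw [Prod.mk.injEq, (eF d k N L j).apply_eq_iff_eq]
    constructor
    · rintro ⟨h1, h2⟩; exact Prod.ext h1 h2
    · rintro rfl; exact ⟨rfl, rfl⟩
  obtain ⟨h1, h2⟩ := eF_step_eq_iff d k N L j ν p q
  simp only [kd, hpq, h1, h2]

/-- **`flatE = stencilE`** (level `0`: `η = 1`). [folklore] -/
theorem flatE_eq_stencil : flatE d k N L = stencilE d k N L := by
  rw [← scaled_LapR_eq_stencil d k N L 0, flatE]
  have h0 : ((side k L 0 : ℝ) ^ 2)⁻¹ = 1 := by simp [side]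
  rw [h0, one_smul]

/-- **THE REMAINDER FORM OF THE FLAT FAMILY, DECOMPOSED** — no Laplacian residue: `flatNg j = −η_j²·RI j Re(∂P_j∂*) +
(η_j²·RI j Re(1·Q*Q) − massKernel (cubeI j) τ_j (1/(L^j)^{d+3}))`, i.e. exactly Bałaban's (negative) gauge part of [B5]
(1.69)–(1.70) plus the deviation of the line-averaged mass term of (1.8) from the block-diagonal mass model. [folklore] -/
theorem flatNg_eq (j : ℕ) :
    flatNg d k N L j
      = -(((side k L j : ℝ) ^ 2)⁻¹ • RI d k N L j
            (reM (GradOp (fine (side k L j) (Mlev d k N L j)) (side k L j : ℂ) * PcT (side k L j) (Mlev d k N L j) (side k L j : ℂ)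
              * (GradOp (fine (side k L j) (Mlev d k N L j)) (side k L j : ℂ))ᴴ)))
        + (((side k L j : ℝ) ^ 2)⁻¹ • RI d k N L j (reM (QvAdj (side k L j) (Mlev d k N L j) * QvOp (side k L j) (Mlev d k N L j)))
          - massKernel (cubeI (d + 1) k N L (Fin (d + 1)) j) (tau (cubeComb (d + 1) k N L j) (flatRm d k N L))
              (flatAm j / ((L : ℝ) ^ j) ^ (d + 1 + 2))) := by
  have hK : kFlat d k N L j = ((side k L j : ℝ) ^ 2)⁻¹ • RI d k N L j (LapR (side k L j) (Mlev d k N L j))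
      - ((side k L j : ℝ) ^ 2)⁻¹ • RI d k N L j
          (reM (GradOp (fine (side k L j) (Mlev d k N L j)) (side k L j : ℂ) * PcT (side k L j) (Mlev d k N L j) (side k L j : ℂ)
            * (GradOp (fine (side k L j) (Mlev d k N L j)) (side k L j : ℂ))ᴴ))
      + ((side k L j : ℝ) ^ 2)⁻¹ • RI d k N L j (reM (QvAdj (side k L j) (Mlev d k N L j) * QvOp (side k L j) (Mlev d k N L j))) := by
    rw [kFlat, DeltaAR, DeltaA, reM_add, reM_sub, show ((1 : ℝ) : ℂ) = (((1 : ℝ)) : ℂ) from rfl, reM_smul_ofReal, one_smul,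
      RI_add, RI_sub, smul_add, smul_sub]
    rfl
  rw [flatNg, hK, flatE_eq_stencil, ← scaled_LapR_eq_stencil d k N L j]
  abel

end Identification

end Summit.QuantumFields.BalabanUV.T4Continuum.SliceFlatStencil
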